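import Literature.NumberTheory.PAdicHodge.TateTwistCoboundary
import Literature.NumberTheory.PAdicHodge.SenFiniteVectorsBase
import Mathlib.Analysis.SpecificLimits.Basic
import HarnessLib

/-!
# Sen–Tate decompletion in rank one: small units of `X = \widehat{K_∞}` are `K_n`-units up to a
`γ`-coboundary

Notation as in `TateInvariantsBase` / `TateTraceKernel` / `TateTwistCoboundary`: `F` a non-archimedean
local field of characteristic `0` and residue characteristic `p`, `K₀ = PadicBase F p hp ≅ ℚ_p`,
`F̄ = NormedAlgClosure F`, `ℂ_F = CompletedAlgClosure F`, `K n = K₀(ζ_{pⁿ}) ⊆ F̄`, `S ⊆ ℂ_F` the image of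
`K_∞ = ⋃ K n`, `X = \widehat{K_∞}` its closure, `γ = γ_n = TateTrace.gen n` (a topological generator of
`Gal(K_∞/K_n)`, `n ≥ 2`), `R_n = TateTrace.Rhat n : X → ℂ_F` Tate's normalised trace, `π = ‖p‖ < 1`.

## Main results

* `TateTrace.one_mem_X`, `TateTrace.mul_mem_X`, `TateTrace.inv_mem_X` — `X` is a (closed) subfield of
  `ℂ_F`.
* ★ `TateTrace.exists_gen_smul_mul_coboundary_eq` — **multiplicative decompletion (rank one).** Let
  `n ≥ 2` and `u ∈ X` with `‖u − 1‖ ≤ ‖p‖⁷`. Then there is `b ∈ X` with `‖b − 1‖ < 1` such that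
  `w := u · γ(b) · b⁻¹` is FIXED by `γ = γ_n`; and (`TateTrace.exists_mem_K_mul_coboundary_eq`) such a `w`
  lies in `K n`, so that

    `u = w · b · γ(b)⁻¹`,  `w ∈ (K n)ˣ`,  `b ∈ 1 + 𝔪_X`:

  every unit of `X` sufficiently close to `1` is a unit of `K n` times a `γ`-coboundary. Equivalently:
  a continuous `1`-cocycle of `γ^{ℤ_p} = Gal(K_∞/K_n)` with values in `Xˣ` whose value at `γ` is
  `‖p‖⁷`-close to `1` is cohomologous to a `K nˣ`-valued (unramified-by-completion) cocycle — the case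
  `d = 1` of the decompletion `H¹(Γ_{K_n}, GL_d(\widehat{K_∞})) ← H¹(Γ_{K_n}, GL_d(K_n))` (surjective on
  small cocycles) at the heart of Sen's theory (Berger–Colmez Cor. 3.2.4), obtained here from Tate's
  normalised traces alone (Colmez's axioms (TS2), (TS3) for the cyclotomic tower are Tate's Prop. 6
  and Prop. 7, tree `TateTrace.norm_Rhat_le`, `TateTrace.norm_sub_Rhat_le`,
  `TateTrace.exists_gen_smul_sub_eq_of_Rhat_eq_zero`).

## Proof

Successive approximation (Sen's method, as axiomatised by Colmez: (TS2) + (TS3) ⇒ decompletion,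
Berger–Colmez Lemme 3.2.3 / Cor. 3.2.4 with `d = 1`). Write
`U = 1 + v` with `v ∈ X` small and suppose `r ∈ X^{γ=1}` approximates `v` to order `E`:
`‖v − r‖ ≤ E`. Put `w = v − r`, `r' = r + R_n w` (still `γ`-fixed, `TateTrace.gen_smul_Rhat`) and
`v₁ = w − R_n w ∈ ker R_n`, `‖v₁‖ ≤ ‖p‖⁻¹ E` (`TateTrace.norm_Rhat_le`). By Tate's Prop. 7
(`TateTrace.exists_gen_smul_sub_eq_of_Rhat_eq_zero` with the estimate `TateTrace.norm_sub_Rhat_le`) there is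
`c ∈ X` with `γc − c = −v₁` and `‖c‖ ≤ ‖p‖⁻³ E`. Then, exactly,

  `U (1 + γc)(1 + c)⁻¹ − 1 − r' = (1 + c)⁻¹ (v·γc − c·r')`,

whose norm is `≤ ‖c‖ · max(‖v‖, ‖r'‖) ≤ ‖p‖⁻³ m E` if `‖r‖, ‖p‖⁻¹E ≤ m` (`private step`). Starting from
`b₀ = 1`, `r₀ = R_n(u − 1)` and iterating `b_{k+1} = b_k (1 + c_k)` the errors decay like `θ^k`,
`θ = ‖p‖⁻⁶‖u − 1‖ ≤ ‖p‖ < 1`, the products `b_k` converge in the closed subfield `X` of the complete field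
`ℂ_F` (`‖b_{k+1} − b_k‖ ≤ ‖c_k‖`), and in the limit `γ v_∞ − v_∞ = lim (γ − 1)(v_k − r_k) = 0`. That the
`γ_n`-invariants of `X` are `K n` is `TateTrace.mem_image_K_of_gen_smul_eq` (Tate's Prop. 7 again).
No named facts are used; the exponent `7 = 2c₂ + 2c₃ + 1` (`c₂ = 1`, `c₃ = 2`) is Berger–Colmez's `b`, not optimised.

References: J. Tate, *p-divisible groups* (1967), §3.2 Prop. 7 [Tate1967]; S. Sen, *Continuous
cohomology and p-adic Galois representations*, Invent. Math. 62 (1980) [Sen1980] (original source of the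
decompletion, not consulted); J.-M. Fontaine, Y. Ouyang, *Theory of p-adic Galois representations*, §3.1
Prop. 3.16 [FontaineOuyang2022]; L. Berger, P. Colmez, *Familles de représentations de de Rham et
monodromie p-adique*, Astérisque 319 (2008), §3.2: conditions (TS1)–(TS3), Lemme 3.2.3 (the contraction
step) and Cor. 3.2.4 (the decompletion `M⁻¹ U γ(M) ∈ 1 + p^k M_d(Λ_{H,n})` for `val(U − 1) ≥ 2c₂ + 2c₃ + δ`;
here `d = 1`, `c₂ = 1`, `c₃ = 2`, `δ = 1`, whence the exponent `7`) [BergerColmez2008].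
-/

noncomputable section

open ValuativeRel Field UniformSpace Filter Topology Finset

open scoped IntermediateField

namespace Literature.NumberTheory.PAdicHodge

open Literature.NumberTheory.GaloisRepresentations
open Literature.NumberTheory.GaloisRepresentations.IsNonarchimedeanLocalField
open CyclotomicTower

variable {F : Type} [Field F] [ValuativeRel F] [TopologicalSpace F] [IsNonarchimedeanLocalField F]
  [CharZero F] {p : ℕ} [Fact p.Prime] (hp : valuation F p < 1)

namespace TateTrace

/-! ### `X = \widehat{K_∞}` is a closed subfield of `ℂ_F` -/

/-- `1 ∈ X`. [cite: Tate1967, §3.1 (X = \widehat{K_∞} is a closed subfield of ℂ)] -/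
theorem one_mem_X : (1 : CompletedAlgClosure F) ∈ X hp :=
  S_subset_X hp ((mem_S_iff hp).mpr ⟨1, one_mem _, by simp⟩)

/-- `S` (the image of `K_∞`) is closed under multiplication. [folklore] -/
private theorem mul_mem_S {x y : CompletedAlgClosure F} (hx : x ∈ S hp) (hy : y ∈ S hp) :
    x * y ∈ S hp := by
  obtain ⟨a, ha, rfl⟩ := (mem_S_iff hp).mp hx
  obtain ⟨b, hb, rfl⟩ := (mem_S_iff hp).mp hy
  exact (mem_S_iff hp).mpr ⟨a * b, mul_mem ha hb, by simp [Completion.coe_mul]⟩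

/-- `S` (the image of `K_∞`) is closed under inversion. [folklore] -/
private theorem inv_mem_S {x : CompletedAlgClosure F} (hx : x ∈ S hp) : x⁻¹ ∈ S hp := by
  obtain ⟨a, ha, rfl⟩ := (mem_S_iff hp).mp hx
  exact (mem_S_iff hp).mpr ⟨a⁻¹, inv_mem ha, by simp [Completion.coe_inv]⟩

/-- `X` is closed under multiplication. [cite: Tate1967, §3.1 (X = \widehat{K_∞} is a closed subfield of ℂ)] -/
theorem mul_mem_X {x y : CompletedAlgClosure F} (hx : x ∈ X hp) (hy : y ∈ X hp) : x * y ∈ X hp :=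
  map_mem_closure₂ continuous_mul hx hy fun _ hs _ ht => mul_mem_S hp hs ht

/-- `X` is closed under inversion (inversion is continuous away from `0`, and `0⁻¹ = 0`).
[cite: Tate1967, §3.1 (X = \widehat{K_∞} is a closed subfield of ℂ)] -/
theorem inv_mem_X {x : CompletedAlgClosure F} (hx : x ∈ X hp) : x⁻¹ ∈ X hp := by
  by_cases h0 : x = 0
  · rw [h0, inv_zero]; exact zero_mem_X hp
  have hcont : ContinuousWithinAt (fun z : CompletedAlgClosure F => z⁻¹) (S hp) x :=
    (continuousAt_inv₀ h0).continuousWithinAt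
  have h1 := hcont.mem_closure_image hx
  refine closure_mono ?_ h1
  rintro _ ⟨s, hs, rfl⟩
  exact inv_mem_S hp hs

/-! ### Ultrametric bookkeeping -/

omit [CharZero F] in
/-- `‖x + y‖ ≤ max ‖x‖ ‖y‖` in `ℂ_F`. [folklore] -/
private theorem norm_add_le_max' (x y : CompletedAlgClosure F) : ‖x + y‖ ≤ max ‖x‖ ‖y‖ :=
  IsUltrametricDist.norm_add_le_max x y

omit [CharZero F] in
/-- `‖x - y‖ ≤ max ‖x‖ ‖y‖` in `ℂ_F`. [folklore] -/
private theorem norm_sub_le_max' (x y : CompletedAlgClosure F) : ‖x - y‖ ≤ max ‖x‖ ‖y‖ := by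
  rw [sub_eq_add_neg, ← norm_neg y]; exact IsUltrametricDist.norm_add_le_max x (-y)

omit [CharZero F] in
/-- `‖1 + c‖ = 1` when `‖c‖ < 1`. [folklore] -/
private theorem norm_one_add_eq {c : CompletedAlgClosure F} (hc : ‖c‖ < 1) : ‖1 + c‖ = 1 := by
  have h := IsUltrametricDist.norm_add_eq_max_of_norm_ne_norm (x := (1 : CompletedAlgClosure F)) (y := c)
    (by rw [norm_one]; exact hc.ne')
  rw [h, norm_one, max_eq_left hc.le]

/-- `‖γ • y − y‖ ≤ ‖y‖`. [folklore] -/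
private theorem norm_gen_smul_sub_le (n : ℕ) (y : CompletedAlgClosure F) :
    ‖gen hp n • y - y‖ ≤ ‖y‖ := by
  refine (norm_sub_le_max' _ _).trans ?_
  rw [CompletedAlgClosure.norm_base_smul hp, max_self]

/-! ### The contraction step -/

/-- **One step of the successive approximation.** `U ∈ X`, `r ∈ X^{γ=1}` with `‖r‖ ≤ m`,
`‖U − 1 − r‖ ≤ E`, `‖p‖⁻¹E ≤ m`, `‖p‖⁻³E < 1`: there are `c ∈ X` with `‖c‖ ≤ ‖p‖⁻³E` and a
`γ`-fixed `r' ∈ X` with `‖r'‖ ≤ m` and `‖U(1 + γc)(1 + c)⁻¹ − 1 − r'‖ ≤ ‖p‖⁻³ m E`. [folklore] -/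
private theorem step {n : ℕ} (hn : 2 ≤ n) {U r : CompletedAlgClosure F} (hU : U ∈ X hp) (hr : r ∈ X hp)
    (hγr : gen hp n • r = r) {m E : ℝ} (hrm : ‖r‖ ≤ m)
    (hEm : ‖(p : PadicBase F p hp)‖⁻¹ * E ≤ m) (hE3 : ‖(p : PadicBase F p hp)‖⁻¹ ^ 3 * E < 1)
    (hE : ‖U - 1 - r‖ ≤ E) :
    ∃ c ∈ X hp, ‖c‖ ≤ ‖(p : PadicBase F p hp)‖⁻¹ ^ 3 * E ∧
      ∃ r' ∈ X hp, gen hp n • r' = r' ∧ ‖r'‖ ≤ m ∧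
        U * (1 + gen hp n • c) * (1 + c)⁻¹ ∈ X hp ∧
        ‖U * (1 + gen hp n • c) * (1 + c)⁻¹ - 1 - r'‖ ≤ ‖(p : PadicBase F p hp)‖⁻¹ ^ 3 * m * E := by
  set π : ℝ := ‖(p : PadicBase F p hp)‖ with hπ
  have hπ0 : 0 < π := norm_pos_iff.mpr (by exact_mod_cast (Fact.out : p.Prime).ne_zero)
  have hπ1 : π < 1 := PadicBase.norm_p_lt_one hp
  have hπi1 : 1 ≤ π⁻¹ := one_le_inv_iff₀.mpr ⟨hπ0, hπ1.le⟩
  have hE0 : 0 ≤ E := (norm_nonneg _).trans hE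
  have hEE : E ≤ π⁻¹ * E := le_mul_of_one_le_left hE0 hπi1
  have hEm' : E ≤ m := hEE.trans hEm
  -- the data
  have hv : U - 1 ∈ X hp := sub_mem_X hp hU (one_mem_X hp)
  have hw : U - 1 - r ∈ X hp := sub_mem_X hp hv hr
  set Rw : CompletedAlgClosure F := Rhat hp n ⟨U - 1 - r, hw⟩ with hRw_def
  have hRwX : Rw ∈ X hp := Rhat_mem_X hp hn _
  have hγRw : gen hp n • Rw = Rw := gen_smul_Rhat hp hn _
  have hRw_norm : ‖Rw‖ ≤ π⁻¹ * E :=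
    (norm_Rhat_le hp hn _).trans (mul_le_mul_of_nonneg_left hE (le_trans zero_le_one hπi1))
  have hv₁X : U - 1 - r - Rw ∈ X hp := sub_mem_X hp hw hRwX
  have hRv₁ : Rhat hp n ⟨U - 1 - r - Rw, hv₁X⟩ = 0 := by
    have h := Rhat_sub hp hn ⟨U - 1 - r, hw⟩ ⟨Rw, hRwX⟩
    have h2 : Rhat hp n ⟨Rw, hRwX⟩ = Rw := Rhat_Rhat hp hn ⟨U - 1 - r, hw⟩
    simp only at h
    rw [h, h2, hRw_def, sub_self]
  have hv₁norm : ‖U - 1 - r - Rw‖ ≤ π⁻¹ * E :=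
    (norm_sub_le_max' _ _).trans (max_le (hE.trans hEE) hRw_norm)
  -- Tate's Prop. 7: solve `γ c' − c' = v₁` in `ker R_n`, with the estimate
  obtain ⟨c', hc'X, hRc', hc'eq⟩ := exists_gen_smul_sub_eq_of_Rhat_eq_zero hp hn hv₁X hRv₁
  have hc'norm : ‖c'‖ ≤ π⁻¹ ^ 3 * E := by
    have h := norm_sub_Rhat_le hp hn ⟨c', hc'X⟩
    simp only [hRc', sub_zero] at h
    rw [hc'eq] at h
    refine h.trans ?_
    calc π⁻¹ ^ 2 * ‖U - 1 - r - Rw‖ ≤ π⁻¹ ^ 2 * (π⁻¹ * E) :=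
          mul_le_mul_of_nonneg_left hv₁norm (pow_nonneg (inv_nonneg.mpr hπ0.le) 2)
      _ = π⁻¹ ^ 3 * E := by ring
  -- `c = −c'`, `r' = r + R_n w`
  refine ⟨-c', neg_mem_X hp hc'X, by rwa [norm_neg], r + Rw, add_mem_X hp hr hRwX,
    by rw [smul_add, hγr, hγRw], (norm_add_le_max' _ _).trans (max_le hrm (hRw_norm.trans hEm)), ?_, ?_⟩
  · -- membership in the subfield `X`
    refine mul_mem_X hp (mul_mem_X hp hU (add_mem_X hp (one_mem_X hp) (smul_mem_X hp _ ?_)))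
      (inv_mem_X hp (add_mem_X hp (one_mem_X hp) (neg_mem_X hp hc'X)))
    exact neg_mem_X hp hc'X
  -- the exact identity
  have hc1 : ‖-c'‖ < 1 := by
    rw [norm_neg]; exact hc'norm.trans_lt hE3
  have hnorm1c : ‖(1 : CompletedAlgClosure F) + -c'‖ = 1 := norm_one_add_eq hc1
  have h1c : (1 : CompletedAlgClosure F) + -c' ≠ 0 := by
    intro h; rw [h, norm_zero] at hnorm1c; exact zero_ne_one hnorm1c
  have hγc : gen hp n • (-c') = -c' - (U - 1 - r - Rw) := by
    rw [smul_neg, ← hc'eq]; ring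
  have hid : U * (1 + gen hp n • (-c')) * (1 + -c')⁻¹ - 1 - (r + Rw) =
      (1 + -c')⁻¹ * ((U - 1) * (gen hp n • (-c')) - (-c') * (r + Rw)) := by
    rw [hγc]
    field_simp
    ring
  rw [hid, norm_mul, norm_inv, hnorm1c, inv_one, one_mul]
  -- the estimate `‖v γc − c r'‖ ≤ ‖c‖ · max(‖v‖, ‖r'‖) ≤ π⁻³ E · m`
  have hvnorm : ‖U - 1‖ ≤ m := by
    have h := norm_add_le_max' (U - 1 - r) r
    rw [sub_add_cancel] at h
    exact h.trans (max_le (hE.trans hEm') hrm)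
  have hr'norm : ‖r + Rw‖ ≤ m := (norm_add_le_max' _ _).trans (max_le hrm (hRw_norm.trans hEm))
  have hm0 : 0 ≤ m := (norm_nonneg _).trans hrm
  have hcn : ‖-c'‖ ≤ π⁻¹ ^ 3 * E := by rwa [norm_neg]
  refine (norm_sub_le_max' _ _).trans (max_le ?_ ?_)
  · rw [norm_mul, CompletedAlgClosure.norm_base_smul hp]
    calc ‖U - 1‖ * ‖-c'‖ ≤ m * (π⁻¹ ^ 3 * E) :=
          mul_le_mul hvnorm hcn (norm_nonneg _) hm0
      _ = π⁻¹ ^ 3 * m * E := by ring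
  · rw [norm_mul]
    calc ‖-c'‖ * ‖r + Rw‖ ≤ π⁻¹ ^ 3 * E * m :=
          mul_le_mul hcn hr'norm (norm_nonneg _) (by positivity)
      _ = π⁻¹ ^ 3 * m * E := by ring

/-- `u · γ(b(1+c)) · (b(1+c))⁻¹ = (u · γb · b⁻¹) · (1 + γc) · (1 + c)⁻¹`. [folklore] -/
private theorem coboundary_mul (n : ℕ) (u b c : CompletedAlgClosure F) :
    u * gen hp n • (b * (1 + c)) * (b * (1 + c))⁻¹ =
      u * gen hp n • b * b⁻¹ * (1 + gen hp n • c) * (1 + c)⁻¹ := by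
  rw [smul_mul', smul_add, smul_one, mul_inv]
  ring

/-! ### The decompletion theorem -/

/-- ★ **Multiplicative decompletion in rank one (Sen–Tate).** Let `n ≥ 2`, `γ = γ_n`, and let `u ∈ X`
with `‖u − 1‖ ≤ ‖p‖⁷`. Then there is `b ∈ X` with `‖b − 1‖ < 1` (so `b ∈ Xˣ`) such that
`w = u · γ(b) · b⁻¹ ∈ X` is fixed by `γ`: the cocycle `u` is a `γ`-coboundary times a `γ`-invariant unit.
Proof: successive approximation driven by Tate's normalised trace (`private step`), convergence of the
products `b_k = ∏_{j<k}(1 + c_j)` in the complete field `ℂ_F` with `X` closed, and continuity.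
[cite: Tate1967, §3.2 Prop. 7] [cite: BergerColmez2008, Lemme 3.2.3 and Cor. 3.2.4 (case d = 1, Λ̃ = ℂ_F)] -/
theorem exists_gen_smul_mul_coboundary_eq {n : ℕ} (hn : 2 ≤ n) {u : CompletedAlgClosure F}
    (hu : u ∈ X hp) (hu1 : ‖u - 1‖ ≤ ‖(p : PadicBase F p hp)‖ ^ 7) :
    ∃ b ∈ X hp, ‖b - 1‖ < 1 ∧ u * gen hp n • b * b⁻¹ ∈ X hp ∧
      gen hp n • (u * gen hp n • b * b⁻¹) = u * gen hp n • b * b⁻¹ := by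
  set π : ℝ := ‖(p : PadicBase F p hp)‖ with hπ
  have hπ0 : 0 < π := norm_pos_iff.mpr (by exact_mod_cast (Fact.out : p.Prime).ne_zero)
  have hπ1 : π < 1 := PadicBase.norm_p_lt_one hp
  have hπi1 : 1 ≤ π⁻¹ := one_le_inv_iff₀.mpr ⟨hπ0, hπ1.le⟩
  have hπi0 : 0 ≤ π⁻¹ := le_trans zero_le_one hπi1
  -- constants: `ε = ‖u − 1‖`, `m = π⁻³ ε`, `θ = π⁻³ m = π⁻⁶ ε ≤ π < 1`
  set ε : ℝ := ‖u - 1‖ with hε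
  have hε0 : 0 ≤ ε := norm_nonneg _
  set m : ℝ := π⁻¹ ^ 3 * ε with hm
  have hm0 : 0 ≤ m := mul_nonneg (pow_nonneg hπi0 3) hε0
  set θ : ℝ := π⁻¹ ^ 3 * m with hθ
  have hθ0 : 0 ≤ θ := mul_nonneg (pow_nonneg hπi0 3) hm0
  have hθπ : θ ≤ π := by
    have h : θ = π⁻¹ ^ 6 * ε := by rw [hθ, hm]; ring
    rw [h]
    calc π⁻¹ ^ 6 * ε ≤ π⁻¹ ^ 6 * π ^ 7 := mul_le_mul_of_nonneg_left hu1 (pow_nonneg hπi0 6)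
      _ = π := by field_simp
  have hθ1 : θ < 1 := hθπ.trans_lt hπ1
  have hθle1 : θ ≤ 1 := hθ1.le
  -- `π⁻² m = π⁻⁵ ε ≤ π²`
  have hm2 : π⁻¹ ^ 2 * m ≤ π ^ 2 := by
    have h : π⁻¹ ^ 2 * m = π⁻¹ ^ 5 * ε := by rw [hm]; ring
    rw [h]
    calc π⁻¹ ^ 5 * ε ≤ π⁻¹ ^ 5 * π ^ 7 := mul_le_mul_of_nonneg_left hu1 (pow_nonneg hπi0 5)
      _ = π ^ 2 := by field_simp
  have hπ2 : π ^ 2 < 1 := pow_lt_one₀ hπ0.le hπ1 two_ne_zero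
  -- the invariant of the iteration, on states `(b, r)`
  let I : ℕ → CompletedAlgClosure F × CompletedAlgClosure F → Prop := fun k s =>
    s.1 ∈ X hp ∧ ‖s.1 - 1‖ ≤ π ^ 2 ∧ s.2 ∈ X hp ∧ gen hp n • s.2 = s.2 ∧ ‖s.2‖ ≤ m ∧
      u * gen hp n • s.1 * s.1⁻¹ ∈ X hp ∧ ‖u * gen hp n • s.1 * s.1⁻¹ - 1 - s.2‖ ≤ π * m * θ ^ k
  have hI_def : ∀ k s, I k s ↔ (s.1 ∈ X hp ∧ ‖s.1 - 1‖ ≤ π ^ 2 ∧ s.2 ∈ X hp ∧ gen hp n • s.2 = s.2 ∧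
      ‖s.2‖ ≤ m ∧ u * gen hp n • s.1 * s.1⁻¹ ∈ X hp ∧
      ‖u * gen hp n • s.1 * s.1⁻¹ - 1 - s.2‖ ≤ π * m * θ ^ k) := fun k s => Iff.rfl
  -- the step
  have hstep : ∀ k (s : CompletedAlgClosure F × CompletedAlgClosure F), I k s →
      ∃ s' : CompletedAlgClosure F × CompletedAlgClosure F, I (k + 1) s' ∧
        ‖s'.1 - s.1‖ ≤ π⁻¹ ^ 2 * m * θ ^ k := by
    rintro k ⟨b, r⟩ ⟨hbX, hb1, hrX, hγr, hrm, hUX, hE⟩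
    simp only at hbX hb1 hrX hγr hrm hUX hE
    have hθk0 : 0 ≤ θ ^ k := pow_nonneg hθ0 k
    have hθk1 : θ ^ k ≤ 1 := pow_le_one₀ hθ0 hθle1
    have hEm : π⁻¹ * (π * m * θ ^ k) ≤ m := by
      have h : π⁻¹ * (π * m * θ ^ k) = m * θ ^ k := by field_simp
      rw [h]; exact mul_le_of_le_one_right hm0 hθk1
    have hE3 : π⁻¹ ^ 3 * (π * m * θ ^ k) < 1 := by
      have h : π⁻¹ ^ 3 * (π * m * θ ^ k) = π⁻¹ ^ 2 * m * θ ^ k := by field_simp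
      rw [h]
      calc π⁻¹ ^ 2 * m * θ ^ k ≤ π ^ 2 * 1 :=
            mul_le_mul hm2 hθk1 hθk0 (pow_nonneg hπ0.le 2)
        _ < 1 := by rw [mul_one]; exact hπ2
    obtain ⟨c, hcX, hcn, r', hr'X, hγr', hr'm, hU'X, hE'⟩ :=
      step hp hn hUX hrX hγr hrm hEm hE3 hE
    have hπne : π ≠ 0 := hπ0.ne'
    have hcn' : ‖c‖ ≤ π⁻¹ ^ 2 * m * θ ^ k := by
      rw [← hπ] at hcn
      refine hcn.trans (le_of_eq ?_)
      field_simp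
    have hc2 : ‖c‖ ≤ π ^ 2 := hcn'.trans
      ((mul_le_of_le_one_right (mul_nonneg (pow_nonneg hπi0 2) hm0) hθk1).trans hm2)
    have hc1 : ‖c‖ < 1 := hc2.trans_lt hπ2
    have hbnorm : ‖b‖ ≤ 1 := by
      have h := norm_add_le_max' (b - 1) 1
      rw [sub_add_cancel, norm_one] at h
      exact h.trans (max_le (hb1.trans hπ2.le) le_rfl)
    refine ⟨⟨b * (1 + c), r'⟩, ⟨mul_mem_X hp hbX (add_mem_X hp (one_mem_X hp) hcX), ?_, hr'X, hγr', hr'm,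
      ?_, ?_⟩, ?_⟩
    · -- `‖b(1+c) − 1‖ ≤ π²`
      have h : b * (1 + c) - 1 = (b - 1) + b * c := by ring
      rw [h]
      refine (norm_add_le_max' _ _).trans (max_le hb1 ?_)
      rw [norm_mul]
      calc ‖b‖ * ‖c‖ ≤ 1 * π ^ 2 := mul_le_mul hbnorm hc2 (norm_nonneg _) zero_le_one
        _ = π ^ 2 := one_mul _
    · simp only
      rw [coboundary_mul hp n u b c]; exact hU'X
    · simp only
      rw [coboundary_mul hp n u b c]
      refine hE'.trans (le_of_eq ?_)
      rw [pow_succ, hθ]; ring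
    · -- `‖b(1+c) − b‖ = ‖b c‖ ≤ ‖c‖`
      simp only
      have h : b * (1 + c) - b = b * c := by ring
      rw [h, norm_mul]
      calc ‖b‖ * ‖c‖ ≤ 1 * (π⁻¹ ^ 2 * m * θ ^ k) := mul_le_mul hbnorm hcn' (norm_nonneg _) zero_le_one
        _ = π⁻¹ ^ 2 * m * θ ^ k := one_mul _
  -- the initial state `(1, R_n(u − 1))`
  have hv0 : u - 1 ∈ X hp := sub_mem_X hp hu (one_mem_X hp)
  have hI0 : I 0 ⟨1, Rhat hp n ⟨u - 1, hv0⟩⟩ := by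
    refine ⟨one_mem_X hp, by rw [sub_self, norm_zero]; exact pow_nonneg hπ0.le 2, Rhat_mem_X hp hn _,
      gen_smul_Rhat hp hn _, ?_, ?_, ?_⟩
    · refine (norm_Rhat_le hp hn _).trans ?_
      simp only
      rw [hm]
      calc π⁻¹ * ε ≤ π⁻¹ ^ 3 * ε := by
            refine mul_le_mul_of_nonneg_right ?_ hε0
            calc π⁻¹ = π⁻¹ ^ 1 := (pow_one _).symm
              _ ≤ π⁻¹ ^ 3 := pow_le_pow_right₀ hπi1 (by norm_num)
        _ = π⁻¹ ^ 3 * ε := rfl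
    · simp only
      rw [smul_one, mul_one, inv_one, mul_one]; exact hu
    · simp only
      rw [smul_one, mul_one, inv_one, mul_one, pow_zero, mul_one]
      refine (norm_sub_Rhat_le hp hn ⟨u - 1, hv0⟩).trans ?_
      simp only
      calc π⁻¹ ^ 2 * ‖gen hp n • (u - 1) - (u - 1)‖ ≤ π⁻¹ ^ 2 * ε :=
            mul_le_mul_of_nonneg_left (norm_gen_smul_sub_le hp n _) (pow_nonneg hπi0 2)
        _ = π * m := by rw [hm]; field_simp
  -- run the iteration
  choose! next hnext using hstep
  obtain ⟨seq, hseq0, hseqS⟩ : ∃ seq : ℕ → CompletedAlgClosure F × CompletedAlgClosure F,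
      seq 0 = ⟨1, Rhat hp n ⟨u - 1, hv0⟩⟩ ∧ ∀ k, seq (k + 1) = next k (seq k) :=
    ⟨fun k => Nat.rec ⟨1, Rhat hp n ⟨u - 1, hv0⟩⟩ (fun k s => next k s) k, rfl, fun _ => rfl⟩
  have hI : ∀ k, I k (seq k) := by
    intro k
    induction k with
    | zero => rw [hseq0]; exact hI0
    | succ k ih => rw [hseqS]; exact (hnext k _ ih).1
  have hdist : ∀ k, dist (seq k).1 (seq (k + 1)).1 ≤ π⁻¹ ^ 2 * m * θ ^ k := by
    intro k
    rw [dist_comm, dist_eq_norm, hseqS]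
    exact (hnext k _ (hI k)).2
  have hcauchy : CauchySeq fun k => (seq k).1 := cauchySeq_of_le_geometric θ (π⁻¹ ^ 2 * m) hθ1 hdist
  obtain ⟨b, hb⟩ := cauchySeq_tendsto_of_complete hcauchy
  -- the limit `b ∈ X`, `‖b − 1‖ ≤ π² < 1`
  have hbX : b ∈ X hp := (isClosed_X hp).mem_of_tendsto hb (Eventually.of_forall fun k => (hI k).1)
  have hb1 : ‖b - 1‖ ≤ π ^ 2 :=
    le_of_tendsto ((continuous_norm.tendsto _).comp (hb.sub_const 1))
      (Eventually.of_forall fun k => (hI k).2.1)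
  have hb1' : ‖b - 1‖ < 1 := hb1.trans_lt hπ2
  have hb0 : b ≠ 0 := by
    intro h; rw [h, zero_sub, norm_neg, norm_one] at hb1'; exact lt_irrefl _ hb1'
  -- the values `U_k = u γ(b_k) b_k⁻¹ → U = u γ(b) b⁻¹`
  have hγcont : Continuous fun z : CompletedAlgClosure F => gen hp n • z :=
    CompletedAlgClosure.continuous_base_smul hp (gen hp n)
  have hU : Tendsto (fun k => u * gen hp n • (seq k).1 * ((seq k).1)⁻¹) atTop
      (𝓝 (u * gen hp n • b * b⁻¹)) :=
    ((tendsto_const_nhds.mul ((hγcont.tendsto b).comp hb)).mul (hb.inv₀ hb0))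
  refine ⟨b, hbX, hb1', mul_mem_X hp (mul_mem_X hp hu (smul_mem_X hp _ hbX)) (inv_mem_X hp hbX), ?_⟩
  -- `‖γ U_k − U_k‖ ≤ π m θ^k → 0`, hence `γ U = U`
  have hsmall : ∀ k, ‖gen hp n • (u * gen hp n • (seq k).1 * ((seq k).1)⁻¹) -
      u * gen hp n • (seq k).1 * ((seq k).1)⁻¹‖ ≤ π * m * θ ^ k := by
    intro k
    obtain ⟨-, -, -, hγr, -, -, hE⟩ := hI k
    set U := u * gen hp n • (seq k).1 * ((seq k).1)⁻¹
    have h : gen hp n • U - U = gen hp n • (U - 1 - (seq k).2) - (U - 1 - (seq k).2) := by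
      rw [smul_sub, smul_sub, smul_one, hγr]; ring
    rw [h]
    exact (norm_gen_smul_sub_le hp n _).trans hE
  have hlim0 : Tendsto (fun k => gen hp n • (u * gen hp n • (seq k).1 * ((seq k).1)⁻¹) -
      u * gen hp n • (seq k).1 * ((seq k).1)⁻¹) atTop (𝓝 0) := by
    refine squeeze_zero_norm hsmall ?_
    have h := (tendsto_pow_atTop_nhds_zero_of_lt_one hθ0 hθ1).const_mul (π * m)
    rw [mul_zero] at h
    exact h
  have hlim1 : Tendsto (fun k => gen hp n • (u * gen hp n • (seq k).1 * ((seq k).1)⁻¹) -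
      u * gen hp n • (seq k).1 * ((seq k).1)⁻¹) atTop
      (𝓝 (gen hp n • (u * gen hp n • b * b⁻¹) - u * gen hp n • b * b⁻¹)) :=
    ((hγcont.tendsto _).comp hU).sub hU
  exact sub_eq_zero.mp (tendsto_nhds_unique hlim1 hlim0)

/-- ★ **Small units of `X` are `K_n`-units times `γ`-coboundaries.** For `n ≥ 2` and `u ∈ X` with
`‖u − 1‖ ≤ ‖p‖⁷` there are `b ∈ X` with `‖b − 1‖ < 1` and `w ∈ K n` (as an element of `ℂ_F`) with
`u · γ_n(b) = w · b`, i.e. `u = w · b · γ_n(b)⁻¹`. (The `γ_n`-invariants of `X` are `K n`: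
`mem_image_K_of_gen_smul_eq`.)
[cite: Tate1967, §3.2 Prop. 7] [cite: BergerColmez2008, Lemme 3.2.3 and Cor. 3.2.4 (case d = 1, Λ̃ = ℂ_F)] -/
theorem exists_mem_K_mul_coboundary_eq {n : ℕ} (hn : 2 ≤ n) {u : CompletedAlgClosure F}
    (hu : u ∈ X hp) (hu1 : ‖u - 1‖ ≤ ‖(p : PadicBase F p hp)‖ ^ 7) :
    ∃ b ∈ X hp, ‖b - 1‖ < 1 ∧ ∃ w ∈ K hp n,
      u * gen hp n • b = (w : CompletedAlgClosure F) * b := by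
  obtain ⟨b, hbX, hb1, hwX, hγw⟩ := exists_gen_smul_mul_coboundary_eq hp hn hu hu1
  obtain ⟨w, hw, hweq⟩ := mem_image_K_of_gen_smul_eq hp hn hwX hγw
  have hb0 : b ≠ 0 := by
    intro h; rw [h, zero_sub, norm_neg, norm_one] at hb1; exact lt_irrefl _ hb1
  refine ⟨b, hbX, hb1, w, hw, ?_⟩
  rw [hweq, inv_mul_cancel_right₀ hb0]

end TateTrace

end Literature.NumberTheory.PAdicHodge
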